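import Literature.AlgebraicGeometry.HodgeTheory.MotivatedClassesAlgebraic
import Summits.HodgeConjecture.HodgeConjecture.Theorems.HeckePrymWeilSummitOffWeilSectorCupProductAlgebraicDivisor
import Literature.AlgebraicGeometry.HodgeTheory.HardLefschetzNFoldHolds
import Literature.AlgebraicGeometry.Motives.FamiliesVHS
import HarnessLib

/-!
# Crux `HodgeConjectureQbar` (stmt-HodgeConjecture-11596), line `registered`: stub D — hard-Lefschetz transfer of motivated-ness above the middle degree

Registered stub `stub_lefschetzTransferMotivatedQbar` of the reshaped skeleton
`Cruxes/HodgeConjectureQbar/Lines/birth.lean` of the crux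
`Summit.HodgeConjecture.HodgeConjecture.Theses.PeriodDeficiency.HodgeConjectureQbar` (the Hodge
conjecture, on the real carriers, for smooth projective complex varieties with a `ℚ̄`-model).
The skeleton cuts the middle range of codimensions `2 ≤ p ≤ n − 2` along André's motivated classes;
this stub says that on a FIXED smooth projective `X` of dimension `n`, "rational `(q,q)`-classes are
motivated for `2 ≤ q`, `2q ≤ n`" (the shape of crux `MotivatedLefschetzSplit.HodgeClassesMotivated`,
stmt-HodgeConjecture-17488, here for `X = X₀ ×_{ℚ̄,σ} ℂ`) already gives the same ABOVE the middle
degree, `n < 2p ≤ 2n − 4`. In print this is immediate from two classical facts, both theorems of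
the tree:

* **hard Lefschetz on Hodge classes** (Voisin I Thm. 6.25, Rem. 6.27, §7.1.2): for `2q + j = n`,
  `Lʲ = ([H] ∪ ·)ʲ` maps the rational `(q,q)`-classes of `H^{2q}(X(ℂ); ℂ)` ONTO the rational
  `(q+j,q+j)`-classes of `H^{2(q+j)}` — the tree's `HardLefschetzNFold.exists_hdg_preimage` for the
  hard Lefschetz datum `nonempty_hardLefschetzNFold_holds n X` (hyperplane class of a projective
  embedding);
* **`A_mot(X)` is stable under `L`** (André 1996, Prop. 2.1 (i): `A_mot(X)_E` is a sub-`E`-algebra of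
  `H(X)` containing the polarisation; here only "motivated ∪ divisor class is motivated" is needed):
  on a generator, `pr_{X*}(α ∪ *_L β) ∪ h = pr_{X*}((α ∪ pr_X^* h) ∪ *_L β)` (projection formula and
  graded commutativity in even degrees), and `α ∪ pr_X^* h` is again algebraic by the DIVISOR case of
  the multiplicativity of algebraic classes (Voisin II Prop. 9.20 for a divisor, which moves in its
  linear system — the tree's unconditional `stub_cupProductAlgebraicDivisor`, p142851), so the
  right-hand side is again a generator (`isMotivatedClass_gysinMap`).

Contents: `cupProduct_divisor_mem_motivatedClasses` (motivated ∪ divisor-supported is motivated,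
unconditional — the `c = 1` case of `cupProduct_mem_motivatedClasses_of_cupProduct_algebraic` with
its multiplicativity hypothesis discharged by the divisor case), `lefschetzL_mem_motivatedClasses_of_mem`
(`Lʲ A_motˡ(X) ⊆ A_mot^{l+j}(X)`), `mem_motivatedClasses_of_lt_of_deepMiddle` (the transfer on any
smooth projective complex `X`), and the registered stub (its specialisation to `X₀ ×_{ℚ̄,σ} ℂ`).

## References

* [Andre1996Motifs] Y. André, Pour une théorie inconditionnelle des motifs, Publ. Math. IHÉS 83
  (1996): §2.1 Déf. 1 and Prop. 2.1 (p. 14), proof (p. 15).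
* [VoisinHodgeI2002] C. Voisin, Hodge Theory and Complex Algebraic Geometry I (2002), Thm. 6.25,
  Rem. 6.27, §7.1.2.
* [VoisinHodgeII2003] C. Voisin, Hodge Theory and Complex Algebraic Geometry II (2003), §9.2.4
  Prop. 9.20.
* [FultonYoungTableaux1997] W. Fulton, Young Tableaux, App. B §B.1 (6) (projection formula).
* [HatcherAT2002] A. Hatcher, Algebraic Topology, §3.2 Thm. 3.11 (graded commutativity).
-/

noncomputable section

-- every declaration of this problem lives in `Summit.HodgeConjecture.HodgeConjecture.…` (summit = sub-problem)
set_option linter.dupNamespace false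

open CategoryTheory AlgebraicGeometry MonoidalCategory CartesianMonoidalCategory
open Literature.AlgebraicTopology.SingularHomology Literature.Geometry.Kaehler
open Literature.AlgebraicGeometry Literature.AlgebraicGeometry.Motives
  Literature.AlgebraicGeometry.HodgeTheory

namespace Summit.HodgeConjecture.HodgeConjecture.Theorems

/-- **Motivated ∪ divisor-supported is motivated, unconditionally** (André 1996, Prop. 2.1 (i) in
the weak form with one factor a divisor class): for `X` smooth projective of dimension `n`,
`x ∈ A_motᵃ(X)_ℂ` and `γ ∈ N¹ H²(X(ℂ); ℂ) = algebraicClasses X 1`, `x ∪ γ ∈ A_motᵉ(X)_ℂ`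
(`2a + 2 = 2e`). On a generator `x = pr_{X*}(α ∪ *_L β)`:
`pr_{X*}(α ∪ *_L β) ∪ γ = pr_{X*}((α ∪ pr_X^* γ) ∪ *_L β)` (projection formula
`gysinMap_cupProduct_map`; associativity and graded commutativity in even degrees), and
`α ∪ pr_X^* γ` is algebraic by flat pull-back (`map_fst_mem_supportedClasses`) and the divisor case
of Voisin II Prop. 9.20 (`stub_cupProductAlgebraicDivisor`, unconditional in the tree), so the
right-hand side is again a generator; for `e > n` the target is `0`.
[cite: Andre1996Motifs, Prop. 2.1 (i) (p. 14) and proof (p. 15)]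
[cite: VoisinHodgeII2003, §9.2.4 Prop. 9.20] [cite: FultonYoungTableaux1997, Appendix B §B.1 (6)] -/
theorem cupProduct_divisor_mem_motivatedClasses {n : ℕ} {X : SchemeOver ℂ}
    (hX : IsSmoothProjective n X) {a e : ℕ} (h : 2 * a + 2 * 1 = 2 * e)
    {x : complexBetti X (2 * a)} (hx : x ∈ motivatedClasses n X a)
    {γ : complexBetti X (2 * 1)} (hγ : γ ∈ algebraicClasses X 1) :
    cupProduct h x γ ∈ motivatedClasses n X e := by
  classical
  by_cases he : e ≤ n
  swap
  · haveI := subsingleton_complexBetti hX (show 2 * n < 2 * e by omega)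
    rw [Subsingleton.elim (cupProduct h x γ) 0]
    exact Submodule.zero_mem _
  suffices hle : motivatedClasses n X a ≤
      (motivatedClasses n X e).comap ((cupProduct h).flip γ) from hle hx
  rw [motivatedClasses_le_iff]
  rintro y ⟨m, Y, hY, μ, ν, hμ, hν, η, hη, a₀, b, b', q, hbb', hab, hq, α, β, hα, hβ, rfl⟩
  rw [Submodule.mem_comap, LinearMap.flip_apply]
  have hXY : IsSmoothProjective (n + m) (X ⊗ Y) := IsSmoothProjective.tensor_holds hX hY
  -- `pr_X^* γ` is a divisor-supported class on `X ⊗ Y` (flat pull-back)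
  have hγ' : complexBetti.map (fst X Y) (2 * 1) γ ∈ algebraicClasses (X ⊗ Y) 1 :=
    map_fst_mem_supportedClasses hX hY hγ
  -- projection formula: `pr_{X*}(w) ∪ γ = pr_{X*}(w ∪ pr_X^* γ)`
  rw [← gysinMap_cupProduct_map hν (AlgPoints.mapContinuous (L := ℂ) (fst X Y))
    (show 2 * (a + m) + 2 * 1 = 2 * (e + m) by omega)
    (show 2 * (e + m) + 2 * (q - 1) = 2 * (n + m) by omega)
    (show 2 * e + 2 * (q - 1) = 2 * n by omega)
    (show 2 * 1 + 2 * (q - 1) = 2 * q by omega) _ _ h]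
  -- `(α ∪ *_L β) ∪ pr_X^* γ = (α ∪ pr_X^* γ) ∪ *_L β` (associativity; graded commutativity, even degrees)
  have hstep : cupProduct (show 2 * (a + m) + 2 * 1 = 2 * (e + m) by omega)
      (cupProduct (show 2 * a₀ + 2 * b' = 2 * (a + m) by omega) α
        (lefschetzInvolution hη.hasHardLefschetz (show 2 * b + 2 * b' = 2 * (n + m) by omega) β))
      (complexBetti.map (fst X Y) (2 * 1) γ) =
    cupProduct (show 2 * (a₀ + 1) + 2 * b' = 2 * (e + m) by omega)
      (cupProduct (two_mul_add_two_mul a₀ 1) α (complexBetti.map (fst X Y) (2 * 1) γ))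
      (lefschetzInvolution hη.hasHardLefschetz (show 2 * b + 2 * b' = 2 * (n + m) by omega) β) := by
    rw [cupProduct_assoc (show 2 * a₀ + 2 * b' = 2 * (a + m) by omega)
        (show 2 * b' + 2 * 1 = 2 * (b' + 1) by omega)
        (show 2 * (a + m) + 2 * 1 = 2 * (e + m) by omega)
        (show 2 * a₀ + 2 * (b' + 1) = 2 * (e + m) by omega),
      cupProduct_gradedComm_holds ℂ (ComplexPoints (X ⊗ Y))
        (show 2 * b' + 2 * 1 = 2 * (b' + 1) by omega) (show 2 * 1 + 2 * b' = 2 * (b' + 1) by omega),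
      Even.neg_one_pow ((even_two_mul b').mul_right (2 * 1)), one_smul,
      ← cupProduct_assoc (two_mul_add_two_mul a₀ 1)
        (show 2 * 1 + 2 * b' = 2 * (b' + 1) by omega)
        (show 2 * (a₀ + 1) + 2 * b' = 2 * (e + m) by omega)
        (show 2 * a₀ + 2 * (b' + 1) = 2 * (e + m) by omega)]
  rw [hstep]
  exact (isMotivatedClass_gysinMap (n := n) (X := X) (p := e) hY μ ν hμ hν hη (a := a₀ + 1) (b := b)
    (b' := b') (q := q - 1) hbb' (by omega) (by omega) (stub_cupProductAlgebraicDivisor hXY hα hγ')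
    hβ).mem_motivatedClasses

/-- **`Lʲ A_motˡ(X)_ℂ ⊆ A_mot^{l+j}(X)_ℂ`**: the iterated Lefschetz operator of a hard Lefschetz datum
`Λ` of `X` (cup product with powers of the divisor-supported hyperplane class `[H]`) preserves
motivated classes — iterate `cupProduct_divisor_mem_motivatedClasses` (`L c = [H] ∪ c = c ∪ [H]` in
even degrees). [cite: Andre1996Motifs, Prop. 2.1 (i) (p. 14)] [cite: VoisinHodgeI2002, §6.2.3 and §7.1.2] -/
theorem lefschetzL_mem_motivatedClasses_of_mem {n : ℕ} {X : SchemeOver ℂ}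
    (Λ : HardLefschetzNFold n X) (hX : IsSmoothProjective n X) :
    ∀ (j l : ℕ) (hm : 2 * l + 2 * j = 2 * (l + j)) {c : complexBetti X (2 * l)},
      c ∈ motivatedClasses n X l → Λ.L j (2 * l) (2 * (l + j)) hm c ∈ motivatedClasses n X (l + j)
  | 0, l, hm, c, hc => by
    have h0 : lefschetzPowTo Λ.hyperplaneClass 0 (2 * l) (2 * (l + 0)) hm c = c := rfl
    rw [HardLefschetzNFold.L, h0]
    exact hc
  | j + 1, l, hm, c, hc => by
    rw [HardLefschetzNFold.L, lefschetzPowTo_succ_apply Λ.hyperplaneClass j (2 * l) (2 * (l + j))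
      (2 * (l + (j + 1))) (by omega) hm (by omega), lefschetzOperator_apply]
    have ih := lefschetzL_mem_motivatedClasses_of_mem Λ hX j l (by omega) hc
    rw [cupProduct_gradedComm_holds ℂ _ (show 2 + 2 * (l + j) = 2 * (l + (j + 1)) by omega)
      (show 2 * (l + j) + 2 * 1 = 2 * (l + (j + 1)) by omega) Λ.hyperplaneClass _,
      show ((-1 : ℂ) ^ (2 * (2 * (l + j)))) = 1 by rw [pow_mul, neg_one_sq, one_pow], one_smul]
    exact cupProduct_divisor_mem_motivatedClasses hX _ ih Λ.hyperplaneClass_mem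

/-- **Hard-Lefschetz transfer of motivated-ness above the middle degree**, on any smooth projective
complex `X` of dimension `n`: if every rational `(q,q)`-class with `2 ≤ q`, `2q ≤ n` is motivated,
then so is every rational `(p,p)`-class with `n < 2p` and `p + 2 ≤ n`. Write `p = q + j` with
`2q + j = n` (`q = n − p ≥ 2`); by hard Lefschetz on Hodge classes (`exists_hdg_preimage` for the
datum `nonempty_hardLefschetzNFold_holds n X`) `c = Lʲ c'` with `c'` rational of type `(q,q)`,
motivated by hypothesis, and `Lʲ` preserves `A_mot` (`lefschetzL_mem_motivatedClasses_of_mem`).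
[cite: VoisinHodgeI2002, Thm. 6.25, Rem. 6.27 and §7.1.2] [cite: Andre1996Motifs, Prop. 2.1 (i) (p. 14)] -/
theorem mem_motivatedClasses_of_lt_of_deepMiddle {n : ℕ} {X : SchemeOver ℂ}
    (hX : IsSmoothProjective n X)
    (hdeep : ∀ (q : ℕ), 2 ≤ q → 2 * q ≤ n → ∀ (c : complexBetti X (2 * q)),
      IsRationalClass c → IsOfHodgeType n X (2 * q) q q c → c ∈ motivatedClasses n X q)
    {p : ℕ} (hnp : n < 2 * p) (hpn : p + 2 ≤ n) (c : complexBetti X (2 * p))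
    (hc : IsRationalClass c) (hpp : IsOfHodgeType n X (2 * p) p p c) :
    c ∈ motivatedClasses n X p := by
  obtain ⟨j, hj⟩ : ∃ j, 2 * p = n + j := ⟨2 * p - n, by omega⟩
  obtain ⟨q, rfl⟩ : ∃ q, p = q + j := ⟨p - j, by omega⟩
  obtain ⟨Λ⟩ := nonempty_hardLefschetzNFold_holds n X hX
  obtain ⟨c', hc', hqq, rfl⟩ := Λ.exists_hdg_preimage (j := j) (k := 2 * q) (by omega)
    (2 * (q + j)) (by omega) q q c hc hpp
  exact lefschetzL_mem_motivatedClasses_of_mem Λ hX j q (by omega) (hdeep q (by omega) (by omega) c' hc' hqq)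

/-- **Stub D of the crux `HodgeConjectureQbar` (line `registered`) — hard-Lefschetz transfer on
`ℚ̄`-varieties.** For every embedding `σ : ℚ̄ →+* ℂ` and every smooth projective
`X = X₀ ×_{ℚ̄,σ} ℂ` of dimension `n`: if the rational `(q,q)`-classes of `X` with `2 ≤ q`, `2q ≤ n`
are motivated, then so are the rational `(p,p)`-classes with `n < 2p`, `p + 2 ≤ n`
(`mem_motivatedClasses_of_lt_of_deepMiddle`; the `ℚ̄`-structure is not used). Unconditional. -/
theorem stub_lefschetzTransferMotivatedQbar :
    ∀ (σ : AlgebraicClosure ℚ →+* ℂ) ⦃n : ℕ⦄ ⦃X₀ : SchemeOver (AlgebraicClosure ℚ)⦄,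
      IsSmoothProjective n ((baseChangeHom σ).obj X₀) →
        (∀ (q : ℕ), 2 ≤ q → 2 * q ≤ n →
          ∀ (c : complexBetti ((baseChangeHom σ).obj X₀) (2 * q)),
            IsRationalClass c → IsOfHodgeType n ((baseChangeHom σ).obj X₀) (2 * q) q q c →
              c ∈ motivatedClasses n ((baseChangeHom σ).obj X₀) q) →
        ∀ (p : ℕ), n < 2 * p → p + 2 ≤ n →
          ∀ (c : complexBetti ((baseChangeHom σ).obj X₀) (2 * p)),
            IsRationalClass c → IsOfHodgeType n ((baseChangeHom σ).obj X₀) (2 * p) p p c →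
              c ∈ motivatedClasses n ((baseChangeHom σ).obj X₀) p :=
  fun _ _ _ hX hdeep _ hnp hpn c hc hpp ↦
    mem_motivatedClasses_of_lt_of_deepMiddle hX hdeep hnp hpn c hc hpp

end Summit.HodgeConjecture.HodgeConjecture.Theorems

end
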